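import Mathlib
import HarnessLib
import Summits.HubbardSuperconductivity.HubbardSuperconductivity.Theorems.KLProgrammeKLRegimeAlphaWtFlowAllReg
import Summits.HubbardSuperconductivity.HubbardSuperconductivity.Theorems.KLProgrammeKLRegimeAlphaWtSectionalFlowDeepVol

/-!
# Route `KLProgramme` — crux K3 ENGINE (stmt-HubbardSuperconductivity-20437 `KLRegimeEngineV17F2`), stub (e) proof-input «(e)-D-ROWS», named row N3 IN THE DEEP WINDOW:
# the weighted rows of the FINE-volume BLOCK covariances at the coarse flow frame (lattice-decoupled twin of E1's `alphaWt_blockSliceCT_bgmFat_klEng_flow_all'` /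
# `alphaWt_towerBlock_klEng_flow_all'`)
# (seat hubbard-kl-k3c4-p1 g25, VL lane; `--supports` 20437; DROWS-SCOPE-g25 §13.8 N2/N3; supplier of `hrow/hcol/hααb` of `…TwoVolumeLipLawOfRowsBase1` at volume `bL`
#  in the deep window, the glued weight being at most the fine weight `klGluedWt_le_klLabelWt_fine`)

* **`alphaWt_blockSliceCT_bgmFat_klEng_flow_deep_vol`** — block form (`nf`, `J₂ ≤ nf+1+db`), any lattice `V ≥ L₃`, any weight rate `J′ ≥ nf+1`;
* **`alphaWt_towerBlock_klEng_flow_deep_vol`** — the tower's indexing `nf := dk−1`, `J₂ := d(k+1)`: rows/cols `≤ Cb·(M/β)/Λ_{d(k+1)}` (`≤ (Cb(M/β)4^d/e₀)·4^{dk}`).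

Compositions of landed theorems; nothing about the model is asserted beyond them; nothing asserts the (D) rows, stub (e), VL, K3 or superconductivity.
References: BGM 2006 §2.8 (2.81), §3 (3.3) [cite: BenfattoGiulianiMastropietro2006].
-/

noncomputable section

namespace Summit.HubbardSuperconductivity.HubbardSuperconductivity.Theorems.TorusFourierL2

set_option linter.dupNamespace false -- summit = problem name (single-conjunct summit), D-0017

open Set Finset Literature.MathematicalPhysics.QuantumLattice Literature.MathematicalPhysics.QuantumLattice.BandSectorCounting
open Literature.MathematicalPhysics.QuantumLattice.FermiRG Literature.Probability.LatticeModels Literature.Analysis.SpecialFunctions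
open Summit.HubbardSuperconductivity.HubbardSuperconductivity.Theorems.DispersionFlow
open Summit.HubbardSuperconductivity.HubbardSuperconductivity.Theorems.KLRegimeSplit
open Summit.HubbardSuperconductivity.HubbardSuperconductivity.Theorems.KLProgrammeLegKernels
open Summit.HubbardSuperconductivity.HubbardSuperconductivity.Theorems.PerturbedFermiCurve
open Summit.HubbardSuperconductivity.HubbardSuperconductivity.Theorems.KLRegimeWick
open Summit.HubbardSuperconductivity.HubbardSuperconductivity.Theorems.EngineV8
open Literature.Probability.LatticeModels.BattleFederbush
open scoped Real Nat

open Classical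

set_option maxHeartbeats 1600000 in -- long binder list and a double sum estimate
/-- **The weighted rows/columns of the BLOCK covariance `S̃ᵀ C^K_{(Λ_{J₂},Λ_{nf+1}]} S̃` on ANY lattice `V ≥ L₃` at the coarse flow frame, deep window** — lattice-decoupled
twin of `alphaWt_blockSliceCT_bgmFat_klEng_flow_all'` (block = sum of slices `hubbardCovSliceCT_eq_sum_klSliceCov`, each slice by
`alphaWt_klSliceCov_bgmFat_klEng_flow_deep_vol`, weight comparison `klScaleWt_le_pow_mul_klScaleWt`): `≤ 4^{db}·(Σ_{j≤db+1} Cα(j,dd))·(M/β)/Λ_{J₂}` for blocks of at most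
`db` slices, window `4^{n+2}·U ≤ 4^{2nf+dd}`. [cite: BenfattoGiulianiMastropietro2006, §2.8 (2.81), §3 (3.3)] -/
theorem alphaWt_blockSliceCT_bgmFat_klEng_flow_deep_vol (db dd : ℕ) :
    ∃ Cb : ℝ, 0 < Cb ∧
      ∀ (G : GeoConsts) (P : SplitConsts) (R : RenConsts) (Q : EngConsts) (cc : ℝ), R.WF2 → 0 < cc → cc ≤ EngineV8.klEngC₃6 P R →
      ∀ μ ∈ klWindowC, ∀ U : ℝ, 0 < U → U ≤ min (EngineV8.klEngU₀3 P R cc) (1 / (R.Gfr 3 + 1)) →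
      ∀ β : ℝ, klBetaMin ≤ β → β ≤ Real.exp (cc / U ^ 2) →
      ∀ (L M : ℕ) [NeZero L] [NeZero M], EngineV8.klEngL₃ β U ≤ L → EngineV8.klEngM₃ β U L ≤ M →
      ∀ n : ℕ, 1 ≤ n → n ≤ nScales β + 1 →
        HistP klPredsV17F2 L M G P Q R β U μ 0 n → FrameOK R U (nScales β) μ (klFlowFrameU L M β U μ n) →
        ∀ (V : ℕ) [NeZero V], EngineV8.klEngL₃ β U ≤ V →
        ∀ nf : ℕ, 1 ≤ nf → ∀ J₂ : ℕ, nf + 1 ≤ J₂ → J₂ ≤ nf + 1 + db → J₂ ≤ nScales β + 1 → (4 : ℝ) ^ (n + 2) * U ≤ (4 : ℝ) ^ (2 * nf + dd) → ∀ J' : ℕ, nf + 1 ≤ J' →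
        (∀ Y : SpaceTimeIdx V M × SectorLeg (sectorCount nf),
          ∑ Y', ‖((sectorSubMatrix V M β (bgmFatMultiplier V M klE0 β (nambuXiCT V μ (klFlowFrameU L M β U μ n)) nf)).transpose *
            hubbardCovSliceCT V M β μ 0 (klFlowFrameU L M β U μ n) (klScale klE0 J₂) (klScale klE0 (nf + 1)) *
            sectorSubMatrix V M β (bgmFatMultiplier V M klE0 β (nambuXiCT V μ (klFlowFrameU L M β U μ n)) nf)) Y Y'‖ *
              EngineV8.klScaleWt V M β J' {EngineV8.latticeLegPos (2 * (2 * M)) Y, EngineV8.latticeLegPos (2 * (2 * M)) Y'} ≤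
            Cb * ((M : ℝ) / β) / klScale klE0 J₂) ∧
        (∀ Y' : SpaceTimeIdx V M × SectorLeg (sectorCount nf),
          ∑ Y, ‖((sectorSubMatrix V M β (bgmFatMultiplier V M klE0 β (nambuXiCT V μ (klFlowFrameU L M β U μ n)) nf)).transpose *
            hubbardCovSliceCT V M β μ 0 (klFlowFrameU L M β U μ n) (klScale klE0 J₂) (klScale klE0 (nf + 1)) *
            sectorSubMatrix V M β (bgmFatMultiplier V M klE0 β (nambuXiCT V μ (klFlowFrameU L M β U μ n)) nf)) Y Y'‖ *
              EngineV8.klScaleWt V M β J' {EngineV8.latticeLegPos (2 * (2 * M)) Y, EngineV8.latticeLegPos (2 * (2 * M)) Y'} ≤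
            Cb * ((M : ℝ) / β) / klScale klE0 J₂) := by
  -- the single-slice constants, one per slice offset `j ≤ db + 1`
  have hsl := fun j : ℕ => alphaWt_klSliceCov_bgmFat_klEng_flow_deep_vol j dd
  choose Cα hCα hbd using hsl
  set Cs : ℝ := ∑ j ∈ range (db + 2), Cα j with hCs
  have hCs0 : 0 < Cs := by
    rw [hCs]; exact Finset.sum_pos (fun j _ => hCα j) ⟨0, Finset.mem_range.2 (by omega)⟩
  refine ⟨(4 : ℝ) ^ db * Cs, by positivity, ?_⟩
  intro G P R Q cc hR2 hcc hcc6 μ hμ U hU hUle β hβmin hβc L M _ _ hL3 hM3 n hn1 hnN hhist hfr V _ hV3 nf hnf J₂ hJ₁ hJ₂ hJ₂N hwin J' hJ'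
  have hβ0 : 0 < β := pos_of_klBetaMin_le hβmin
  have hM0 : (0 : ℝ) < M := Nat.cast_pos.2 (Nat.pos_of_ne_zero (NeZero.ne M))
  set K : TrigPolyC4v := klFlowFrameU L M β U μ n with hKdef
  set S : Matrix (HubbardFieldIdx V M) (SpaceTimeIdx V M × SectorLeg (sectorCount nf)) ℂ :=
    sectorSubMatrix V M β (bgmFatMultiplier V M klE0 β (nambuXiCT V μ K) nf) with hSdef
  -- the block as a sum of slices
  obtain ⟨t, rfl⟩ : ∃ t, J₂ = nf + 1 + t := ⟨J₂ - (nf + 1), by omega⟩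
  have ht : t ≤ db := by omega
  have hblock : S.transpose * hubbardCovSliceCT V M β μ 0 K (klScale klE0 (nf + 1 + t)) (klScale klE0 (nf + 1)) * S =
      ∑ s ∈ Finset.Ico (nf + 1 + 1) (nf + 1 + t + 1), S.transpose * klSliceCov V M β μ K s * S := by
    rw [hubbardCovSliceCT_eq_sum_klSliceCov, Matrix.mul_sum, Matrix.sum_mul]
  -- per slice `s = nf + j`, `2 ≤ j ≤ t + 1`: the single-slice bound at weight `max J′ s`, then the weight comparison
  have hΛJ₂ : ∀ s ∈ Finset.Ico (nf + 1 + 1) (nf + 1 + t + 1), 1 / klScale klE0 s ≤ 1 / klScale klE0 (nf + 1 + t) := fun s hs =>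
    one_div_le_one_div_of_le (klth_klScale_pos _) (EngineV8.klScale_le_klScale (by norm_num [klE0]) (by
      have := (Finset.mem_Ico.1 hs).2; omega))
  have hper : ∀ s ∈ Finset.Ico (nf + 1 + 1) (nf + 1 + t + 1),
      (∀ Y : SpaceTimeIdx V M × SectorLeg (sectorCount nf),
        ∑ Y', ‖(S.transpose * klSliceCov V M β μ K s * S) Y Y'‖ *
          EngineV8.klScaleWt V M β J' {EngineV8.latticeLegPos (2 * (2 * M)) Y, EngineV8.latticeLegPos (2 * (2 * M)) Y'} ≤
          (4 : ℝ) ^ db * Cα (s - nf) * ((M : ℝ) / β) / klScale klE0 (nf + 1 + t)) ∧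
      (∀ Y' : SpaceTimeIdx V M × SectorLeg (sectorCount nf),
        ∑ Y, ‖(S.transpose * klSliceCov V M β μ K s * S) Y Y'‖ *
          EngineV8.klScaleWt V M β J' {EngineV8.latticeLegPos (2 * (2 * M)) Y, EngineV8.latticeLegPos (2 * (2 * M)) Y'} ≤
          (4 : ℝ) ^ db * Cα (s - nf) * ((M : ℝ) / β) / klScale klE0 (nf + 1 + t)) := by
    intro s hs
    have hs1 := (Finset.mem_Ico.1 hs).1
    have hs2 := (Finset.mem_Ico.1 hs).2
    have hsj : nf + (s - nf) = s := by omega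
    -- the single slice at weight level `nw := max J′ s`
    have h1 := hbd (s - nf) G P R Q cc hR2 hcc hcc6 μ hμ U hU hUle β hβmin hβc L M hL3 hM3 n hn1 hnN hhist hfr V hV3 nf hnf (by omega) hwin
      (max J' s) (by omega)
    rw [hsj] at h1
    obtain ⟨hrow, hcol⟩ := h1
    -- the weight comparison `klScaleWt J′ ≤ 4^{max J′ s − J′}·klScaleWt (max J′ s) ≤ 4^{db}·…`
    have hwt : ∀ T : Finset (ZMod (2 * (2 * M)) × TorusSite 2 V),
        EngineV8.klScaleWt V M β J' T ≤ (4 : ℝ) ^ db * EngineV8.klScaleWt V M β (max J' s) T := by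
      intro T
      refine (klScaleWt_le_pow_mul_klScaleWt β (le_max_left J' s) T).trans ?_
      have hT0 : 0 ≤ EngineV8.klScaleWt V M β (max J' s) T := by
        rw [klScaleWt_apply]; have := labelDiam_nonneg (gridLabelDist V (2 * (2 * M)) β) T
        have := (klth_klScale_pos (max J' s)).le; positivity
      exact mul_le_mul_of_nonneg_right (pow_le_pow_right₀ (by norm_num) (by omega)) hT0
    have hC0 : 0 ≤ Cα (s - nf) * ((M : ℝ) / β) / klScale klE0 s := by
      have := hCα (s - nf); have := klth_klScale_pos s; positivity
    have hup : Cα (s - nf) * ((M : ℝ) / β) / klScale klE0 s ≤ Cα (s - nf) * ((M : ℝ) / β) / klScale klE0 (nf + 1 + t) := by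
      rw [div_eq_mul_one_div, div_eq_mul_one_div (Cα (s - nf) * _)]
      exact mul_le_mul_of_nonneg_left (hΛJ₂ s hs) (by have := hCα (s - nf); positivity)
    constructor
    · intro Y
      calc ∑ Y', ‖(S.transpose * klSliceCov V M β μ K s * S) Y Y'‖ *
            EngineV8.klScaleWt V M β J' {EngineV8.latticeLegPos (2 * (2 * M)) Y, EngineV8.latticeLegPos (2 * (2 * M)) Y'}
          ≤ ∑ Y', ‖(S.transpose * klSliceCov V M β μ K s * S) Y Y'‖ *
            ((4 : ℝ) ^ db * EngineV8.klScaleWt V M β (max J' s) {EngineV8.latticeLegPos (2 * (2 * M)) Y, EngineV8.latticeLegPos (2 * (2 * M)) Y'}) :=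
            Finset.sum_le_sum fun Y' _ => mul_le_mul_of_nonneg_left (hwt _) (norm_nonneg _)
        _ = (4 : ℝ) ^ db * ∑ Y', ‖(S.transpose * klSliceCov V M β μ K s * S) Y Y'‖ *
            EngineV8.klScaleWt V M β (max J' s) {EngineV8.latticeLegPos (2 * (2 * M)) Y, EngineV8.latticeLegPos (2 * (2 * M)) Y'} := by
            rw [Finset.mul_sum]; exact Finset.sum_congr rfl fun Y' _ => by ring
        _ ≤ (4 : ℝ) ^ db * (Cα (s - nf) * ((M : ℝ) / β) / klScale klE0 s) := mul_le_mul_of_nonneg_left (hrow Y) (by positivity)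
        _ ≤ (4 : ℝ) ^ db * (Cα (s - nf) * ((M : ℝ) / β) / klScale klE0 (nf + 1 + t)) := mul_le_mul_of_nonneg_left hup (by positivity)
        _ = (4 : ℝ) ^ db * Cα (s - nf) * ((M : ℝ) / β) / klScale klE0 (nf + 1 + t) := by ring
    · intro Y'
      calc ∑ Y, ‖(S.transpose * klSliceCov V M β μ K s * S) Y Y'‖ *
            EngineV8.klScaleWt V M β J' {EngineV8.latticeLegPos (2 * (2 * M)) Y, EngineV8.latticeLegPos (2 * (2 * M)) Y'}
          ≤ ∑ Y, ‖(S.transpose * klSliceCov V M β μ K s * S) Y Y'‖ *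
            ((4 : ℝ) ^ db * EngineV8.klScaleWt V M β (max J' s) {EngineV8.latticeLegPos (2 * (2 * M)) Y, EngineV8.latticeLegPos (2 * (2 * M)) Y'}) :=
            Finset.sum_le_sum fun Y _ => mul_le_mul_of_nonneg_left (hwt _) (norm_nonneg _)
        _ = (4 : ℝ) ^ db * ∑ Y, ‖(S.transpose * klSliceCov V M β μ K s * S) Y Y'‖ *
            EngineV8.klScaleWt V M β (max J' s) {EngineV8.latticeLegPos (2 * (2 * M)) Y, EngineV8.latticeLegPos (2 * (2 * M)) Y'} := by
            rw [Finset.mul_sum]; exact Finset.sum_congr rfl fun Y _ => by ring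
        _ ≤ (4 : ℝ) ^ db * (Cα (s - nf) * ((M : ℝ) / β) / klScale klE0 s) := mul_le_mul_of_nonneg_left (hcol Y') (by positivity)
        _ ≤ (4 : ℝ) ^ db * (Cα (s - nf) * ((M : ℝ) / β) / klScale klE0 (nf + 1 + t)) := mul_le_mul_of_nonneg_left hup (by positivity)
        _ = (4 : ℝ) ^ db * Cα (s - nf) * ((M : ℝ) / β) / klScale klE0 (nf + 1 + t) := by ring
  -- the sum of the per-slice constants is at most `Cs`
  have hsumC : ∑ s ∈ Finset.Ico (nf + 1 + 1) (nf + 1 + t + 1), (4 : ℝ) ^ db * Cα (s - nf) * ((M : ℝ) / β) / klScale klE0 (nf + 1 + t) ≤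
      (4 : ℝ) ^ db * Cs * ((M : ℝ) / β) / klScale klE0 (nf + 1 + t) := by
    have e : ∑ s ∈ Finset.Ico (nf + 1 + 1) (nf + 1 + t + 1), (4 : ℝ) ^ db * Cα (s - nf) * ((M : ℝ) / β) / klScale klE0 (nf + 1 + t) =
        (4 : ℝ) ^ db * (∑ s ∈ Finset.Ico (nf + 1 + 1) (nf + 1 + t + 1), Cα (s - nf)) * ((M : ℝ) / β) / klScale klE0 (nf + 1 + t) := by
      rw [Finset.mul_sum, Finset.sum_mul, Finset.sum_div]
    rw [e]
    have hΛ0 : 0 < klScale klE0 (nf + 1 + t) := klth_klScale_pos _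
    have hsub : ∑ s ∈ Finset.Ico (nf + 1 + 1) (nf + 1 + t + 1), Cα (s - nf) ≤ Cs := by
      rw [hCs]
      have himg : ∑ s ∈ Finset.Ico (nf + 1 + 1) (nf + 1 + t + 1), Cα (s - nf) = ∑ j ∈ Finset.Ico 2 (t + 2), Cα j := by
        have e1 : Finset.Ico (nf + 1 + 1) (nf + 1 + t + 1) = (Finset.Ico 2 (t + 2)).map (addRightEmbedding nf) := by
          rw [Finset.map_add_right_Ico]; congr 1 <;> ring
        rw [e1, Finset.sum_map]
        refine Finset.sum_congr rfl fun j _ => ?_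
        simp [addRightEmbedding]
      rw [himg]
      exact Finset.sum_le_sum_of_subset_of_nonneg (fun j hj => by
        have := Finset.mem_Ico.1 hj; exact Finset.mem_range.2 (by omega)) (fun j _ _ => (hCα j).le)
    have hMβ0 : 0 ≤ (M : ℝ) / β := by positivity
    exact div_le_div_of_nonneg_right (mul_le_mul_of_nonneg_right (mul_le_mul_of_nonneg_left hsub (by positivity)) hMβ0) hΛ0.le
  -- assemble: entries of the sum, norms subadditive, sums swapped
  refine ⟨fun Y => ?_, fun Y' => ?_⟩
  · rw [hblock]
    calc ∑ Y', ‖(∑ s ∈ Finset.Ico (nf + 1 + 1) (nf + 1 + t + 1), S.transpose * klSliceCov V M β μ K s * S) Y Y'‖ *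
          EngineV8.klScaleWt V M β J' {EngineV8.latticeLegPos (2 * (2 * M)) Y, EngineV8.latticeLegPos (2 * (2 * M)) Y'}
        ≤ ∑ Y', ∑ s ∈ Finset.Ico (nf + 1 + 1) (nf + 1 + t + 1), ‖(S.transpose * klSliceCov V M β μ K s * S) Y Y'‖ *
          EngineV8.klScaleWt V M β J' {EngineV8.latticeLegPos (2 * (2 * M)) Y, EngineV8.latticeLegPos (2 * (2 * M)) Y'} := by
          refine Finset.sum_le_sum fun Y' _ => ?_
          rw [Matrix.sum_apply, ← Finset.sum_mul]
          refine mul_le_mul_of_nonneg_right (norm_sum_le _ _) ?_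
          rw [klScaleWt_apply]; have := labelDiam_nonneg (gridLabelDist V (2 * (2 * M)) β)
            {EngineV8.latticeLegPos (2 * (2 * M)) Y, EngineV8.latticeLegPos (2 * (2 * M)) Y'}
          have := (klth_klScale_pos J').le; positivity
      _ = ∑ s ∈ Finset.Ico (nf + 1 + 1) (nf + 1 + t + 1), ∑ Y', ‖(S.transpose * klSliceCov V M β μ K s * S) Y Y'‖ *
          EngineV8.klScaleWt V M β J' {EngineV8.latticeLegPos (2 * (2 * M)) Y, EngineV8.latticeLegPos (2 * (2 * M)) Y'} := Finset.sum_comm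
      _ ≤ ∑ s ∈ Finset.Ico (nf + 1 + 1) (nf + 1 + t + 1), (4 : ℝ) ^ db * Cα (s - nf) * ((M : ℝ) / β) / klScale klE0 (nf + 1 + t) :=
          Finset.sum_le_sum fun s hs => (hper s hs).1 Y
      _ ≤ (4 : ℝ) ^ db * Cs * ((M : ℝ) / β) / klScale klE0 (nf + 1 + t) := hsumC
  · rw [hblock]
    calc ∑ Y, ‖(∑ s ∈ Finset.Ico (nf + 1 + 1) (nf + 1 + t + 1), S.transpose * klSliceCov V M β μ K s * S) Y Y'‖ *
          EngineV8.klScaleWt V M β J' {EngineV8.latticeLegPos (2 * (2 * M)) Y, EngineV8.latticeLegPos (2 * (2 * M)) Y'}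
        ≤ ∑ Y, ∑ s ∈ Finset.Ico (nf + 1 + 1) (nf + 1 + t + 1), ‖(S.transpose * klSliceCov V M β μ K s * S) Y Y'‖ *
          EngineV8.klScaleWt V M β J' {EngineV8.latticeLegPos (2 * (2 * M)) Y, EngineV8.latticeLegPos (2 * (2 * M)) Y'} := by
          refine Finset.sum_le_sum fun Y _ => ?_
          rw [Matrix.sum_apply, ← Finset.sum_mul]
          refine mul_le_mul_of_nonneg_right (norm_sum_le _ _) ?_
          rw [klScaleWt_apply]; have := labelDiam_nonneg (gridLabelDist V (2 * (2 * M)) β)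
            {EngineV8.latticeLegPos (2 * (2 * M)) Y, EngineV8.latticeLegPos (2 * (2 * M)) Y'}
          have := (klth_klScale_pos J').le; positivity
      _ = ∑ s ∈ Finset.Ico (nf + 1 + 1) (nf + 1 + t + 1), ∑ Y, ‖(S.transpose * klSliceCov V M β μ K s * S) Y Y'‖ *
          EngineV8.klScaleWt V M β J' {EngineV8.latticeLegPos (2 * (2 * M)) Y, EngineV8.latticeLegPos (2 * (2 * M)) Y'} := Finset.sum_comm
      _ ≤ ∑ s ∈ Finset.Ico (nf + 1 + 1) (nf + 1 + t + 1), (4 : ℝ) ^ db * Cα (s - nf) * ((M : ℝ) / β) / klScale klE0 (nf + 1 + t) :=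
          Finset.sum_le_sum fun s hs => (hper s hs).2 Y'
      _ ≤ (4 : ℝ) ^ db * Cs * ((M : ℝ) / β) / klScale klE0 (nf + 1 + t) := hsumC

set_option maxHeartbeats 800000 in -- long binder list
/-- **The fine-volume block rows in the tower's indexing, deep window**: `alphaWt_blockSliceCT_bgmFat_klEng_flow_deep_vol d dd` at `nf := dk−1`, `J₂ := d(k+1)`, rate
`j ≥ dk`: E1-shaped `hrow/hcol` of the two-volume LINK at every block `k ≥ 1` (`2 ≤ dk`, `d(k+1) ≤ n_β+1`, window `4^{n+2}U ≤ 4^{2(dk−1)+dd}`), any lattice `V ≥ L₃`.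
[cite: BenfattoGiulianiMastropietro2006, §2.8 (2.81), §3 (3.3)] -/
theorem alphaWt_towerBlock_klEng_flow_deep_vol (d dd : ℕ) :
    ∃ Cb : ℝ, 0 < Cb ∧
      ∀ (G : GeoConsts) (P : SplitConsts) (R : RenConsts) (Q : EngConsts) (cc : ℝ), R.WF2 → 0 < cc → cc ≤ EngineV8.klEngC₃6 P R →
      ∀ μ ∈ klWindowC, ∀ U : ℝ, 0 < U → U ≤ min (EngineV8.klEngU₀3 P R cc) (1 / (R.Gfr 3 + 1)) →
      ∀ β : ℝ, klBetaMin ≤ β → β ≤ Real.exp (cc / U ^ 2) →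
      ∀ (L M : ℕ) [NeZero L] [NeZero M], EngineV8.klEngL₃ β U ≤ L → EngineV8.klEngM₃ β U L ≤ M →
      ∀ n : ℕ, 1 ≤ n → n ≤ nScales β + 1 →
        HistP klPredsV17F2 L M G P Q R β U μ 0 n → FrameOK R U (nScales β) μ (klFlowFrameU L M β U μ n) →
        ∀ (V : ℕ) [NeZero V], EngineV8.klEngL₃ β U ≤ V →
        ∀ k : ℕ, 1 ≤ k → 2 ≤ d * k → d * (k + 1) ≤ nScales β + 1 → (4 : ℝ) ^ (n + 2) * U ≤ (4 : ℝ) ^ (2 * (d * k - 1) + dd) → ∀ j : ℕ, d * k ≤ j →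
        (∀ Y : SpaceTimeIdx V M × SectorLeg (sectorCount (d * k - 1)),
          ∑ Y', ‖((sectorSubMatrix V M β (bgmFatMultiplier V M klE0 β (nambuXiCT V μ (klFlowFrameU L M β U μ n)) (d * k - 1))).transpose *
            hubbardCovSliceCT V M β μ 0 (klFlowFrameU L M β U μ n) (klScale klE0 (d * (k + 1))) (klScale klE0 (d * k)) *
            sectorSubMatrix V M β (bgmFatMultiplier V M klE0 β (nambuXiCT V μ (klFlowFrameU L M β U μ n)) (d * k - 1))) Y Y'‖ *
              EngineV8.klScaleWt V M β j {EngineV8.latticeLegPos (2 * (2 * M)) Y, EngineV8.latticeLegPos (2 * (2 * M)) Y'} ≤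
            Cb * ((M : ℝ) / β) / klScale klE0 (d * (k + 1))) ∧
        (∀ Y' : SpaceTimeIdx V M × SectorLeg (sectorCount (d * k - 1)),
          ∑ Y, ‖((sectorSubMatrix V M β (bgmFatMultiplier V M klE0 β (nambuXiCT V μ (klFlowFrameU L M β U μ n)) (d * k - 1))).transpose *
            hubbardCovSliceCT V M β μ 0 (klFlowFrameU L M β U μ n) (klScale klE0 (d * (k + 1))) (klScale klE0 (d * k)) *
            sectorSubMatrix V M β (bgmFatMultiplier V M klE0 β (nambuXiCT V μ (klFlowFrameU L M β U μ n)) (d * k - 1))) Y Y'‖ *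
              EngineV8.klScaleWt V M β j {EngineV8.latticeLegPos (2 * (2 * M)) Y, EngineV8.latticeLegPos (2 * (2 * M)) Y'} ≤
            Cb * ((M : ℝ) / β) / klScale klE0 (d * (k + 1))) := by
  obtain ⟨Cb, hCb, h⟩ := alphaWt_blockSliceCT_bgmFat_klEng_flow_deep_vol d dd
  refine ⟨Cb, hCb, ?_⟩
  intro G P R Q cc hR2 hcc hcc6 μ hμ U hU hUle β hβmin hβc L M _ _ hL3 hM3 n hn1 hnN hhist hfr V _ hV3 k hk hdk hkN hwin j hj
  have e1 : d * k - 1 + 1 = d * k := by omega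
  have h' := h G P R Q cc hR2 hcc hcc6 μ hμ U hU hUle β hβmin hβc L M hL3 hM3 n hn1 hnN hhist hfr V hV3 (d * k - 1) (by omega) (d * (k + 1))
    (by rw [e1]; exact Nat.mul_le_mul_left d (Nat.le_succ k)) (by rw [e1, Nat.mul_succ]) hkN hwin j (by omega)
  rw [e1] at h'
  exact h'

end Summit.HubbardSuperconductivity.HubbardSuperconductivity.Theorems.TorusFourierL2

end
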